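import Summits.CriticalPhenomena.PercolationContinuityZ3.Theorems.SahiMasterFamilyPhiCertPoly

/-!
# A checkable certificate format for the principal-cap inequalities `F(n)` (`PhiNonneg n`), part 2: the symbolic Lieb–Sahi
# recursion, atoms, orbit expansion, and the reflection theorem `phiNonneg_of_verify`

Unit `prim-masterthm-p4` (gen 13; crux anchor stmt-CriticalPhenomena-4575, helper work; memo
`run/shared/lean/prim/prim-masterthm/prim-masterthm-p4/P4-GEN13-REPORT.md` §7, §9).  Continues `…PhiCertPoly` (syntax `Poly`, `evalP`, sound
`mulP`/`scaleP`/`normP`).  Here: the variables `β_S` read through bitmasks (`ofMask`, `val`, full mask ↦ `1`), the SYMBOLIC Lieb–Sahi recursion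
`symE` computing Sahi's `E_n` of a family of products of coordinate indicators in the canonical signed model `realW β` of `…PrincipalCapBetaSmall`
(`symE_sound`, mirroring `sahiE_succ_succ`; `evalP_symE_singletons : evalP (symE n n singletons) = Φ_n(β)`), the atoms `b_S = β_S`, `d_S = 1 − β_S`,
`h(S;A,B) = β_S − β_Aβ_B` and weighted products (`termsPoly`, `termsPoly_nonneg` on the constraint set of `F(n)`), the orbit expansion of a
symmetry-reduced certificate under all permutations (`certTerms`; no soundness needed beyond the data check `checkT` of its OUTPUT), and
**`phiNonneg_of_verify : verify (n+1) M C = true → PhiNonneg (n+1)`** (`verify` = data check ∧ equal normal forms of `M·Φ` and the certificate).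
So each certificate of the shape `Φ_n = (1/n!) Σ_{g∈S_n} Σ_t c_t g·∏atoms_t` (kit j122110 for n = 6: 15 terms; kit j124604 for n = 7: 50 terms) becomes ONE
evaluation of `verify` (by compiled evaluation in `…PhiCertSeven`; the kernel's own evaluator runs out of memory already at n = 6).
HONEST FRAMING: infrastructure; the mathematics is in the certificates.  Axioms standard. [this work]
-/

set_option autoImplicit false

namespace Summit.CriticalPhenomena.PercolationContinuityZ3.Theorems

namespace PhiCert

open Finset Literature.Combinatorics.Sahi2008

/-! ## The variables: `β_S` for bitmasks `S`, with `β_⊤ := 1` -/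

/-- The subset of `Fin n` coded by a bitmask. [this work] -/
def ofMask (n : ℕ) (S : ℕ) : Finset (Fin n) := univ.filter fun i => Nat.testBit S i

/-- `ofMask` turns `|||` into `∪`. [this work] -/
theorem ofMask_or (n : ℕ) (A B : ℕ) : ofMask n (A ||| B) = ofMask n A ∪ ofMask n B := by
  ext i
  simp [ofMask]

/-- The full mask is `univ`. [this work] -/
theorem ofMask_full (n : ℕ) : ofMask n (2 ^ n - 1) = univ := by
  ext i
  simp [ofMask, Nat.testBit_two_pow_sub_one]

/-- Powers of two are singletons. [this work] -/
theorem ofMask_two_pow {n : ℕ} (i : Fin n) : ofMask n (2 ^ (i : ℕ)) = {i} := by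
  ext j
  simp only [ofMask, mem_filter, mem_univ, true_and, Nat.testBit_two_pow, mem_singleton, decide_eq_true_eq]
  constructor
  · intro h; exact Fin.ext h.symm
  · intro h; rw [h]

/-- The valuation `β_S` read through bitmasks. [this work] -/
noncomputable def val {n : ℕ} (β : Finset (Fin n) → ℝ) : ℕ → ℝ := fun S => β (ofMask n S)

/-- The monomial `β_S`, with the full mask read as the constant `1`. [this work] -/
def mono (n : ℕ) (S : ℕ) : Poly := if S = 2 ^ n - 1 then [([], 1)] else [([S], 1)]

/-- `mono` evaluates to `β_S` when `β_⊤ = 1`. [this work] -/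
theorem evalP_mono {n : ℕ} (β : Finset (Fin n) → ℝ) (huniv : β univ = 1) (S : ℕ) :
    evalP (val β) (mono n S) = val β S := by
  unfold mono
  split_ifs with h
  · rw [evalP, evalP, evalM, h, val, ofMask_full, huniv]; push_cast; ring
  · rw [evalP, evalP, evalM, evalM]; push_cast; ring

/-! ## The symbolic Lieb–Sahi recursion in the canonical signed model -/

/-- **Symbolic `E_m`** of the family of indicator products `∏_{j ∈ L i} realF j` (`L i` a bitmask), as a polynomial in the `β_S`
(the Lieb–Sahi recursion `sahiE_succ_succ`, products of indicator products = unions of masks). [this work] -/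
def symE (n : ℕ) : (m : ℕ) → (Fin m → ℕ) → Poly
  | 0, _ => []
  | 1, L => mono n (L 0)
  | m + 2, L =>
      (List.finRange (m + 1)).foldr
          (fun i acc => symE n (m + 1) (Function.update (Fin.tail L) i (Fin.tail L i ||| L 0)) ++ acc) []
        ++ scaleP (-1) (mulP (symE n (m + 1) (Fin.tail L)) (mono n (L 0)))

section Model

variable {n : ℕ}

open PrincipalCapBeta (realF realW)

/-- The family of indicator products coded by masks. [this work] -/
noncomputable def fam {m : ℕ} (L : Fin m → ℕ) : Fin m → Finset (Fin n) → ℝ :=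
  fun i => ∏ j ∈ ofMask n (L i), realF j

/-- Products of indicator products are indicator products of unions. [this work] -/
theorem prod_realF_mul (S T : Finset (Fin n)) :
    (∏ j ∈ S, (realF j : Finset (Fin n) → ℝ)) * (∏ j ∈ T, realF j) = ∏ j ∈ S ∪ T, realF j := by
  funext X
  rw [Pi.mul_apply, PrincipalCapBeta.prod_realF_apply, PrincipalCapBeta.prod_realF_apply, PrincipalCapBeta.prod_realF_apply]
  by_cases hS : S ⊆ X <;> by_cases hT : T ⊆ X <;> simp [hS, hT, Finset.union_subset_iff]

/-- Evaluation of a `foldr`-sum of polynomials. [this work] -/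
theorem evalP_foldr (v : ℕ → ℝ) {m : ℕ} (F : Fin m → Poly) (l : List (Fin m)) :
    evalP v (l.foldr (fun i acc => F i ++ acc) []) = (l.map fun i => evalP v (F i)).sum := by
  induction l with
  | nil => rfl
  | cons i l ih => rw [List.foldr_cons, evalP_append, ih, List.map_cons, List.sum_cons]

/-- **Soundness of the symbolic recursion**: `evalP (symE m L) = E_m(realW β; ∏_{j∈L i} realF j)` when `β univ = 1`. [this work] -/
theorem symE_sound (β : Finset (Fin n) → ℝ) (huniv : β univ = 1) :
    ∀ (m : ℕ) (L : Fin m → ℕ), evalP (val β) (symE n m L) = sahiE (realW β) m (fam L)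
  | 0, L => by rw [symE, evalP, sahiE_zero]
  | 1, L => by
    rw [symE, evalP_mono β huniv, sahiE_one_apply, fam, PrincipalCapBeta.ex_realW_prod]; rfl
  | m + 2, L => by
    rw [symE, evalP_append, evalP_foldr, evalP_scaleP, evalP_mulP, evalP_mono β huniv, symE_sound β huniv (m + 1),
      sahiE_succ_succ, ← Fin.sum_univ_def]
    have htail : fam (Fin.tail L) = Fin.tail (fam L : Fin (m + 2) → Finset (Fin n) → ℝ) := rfl
    have hupd : ∀ i : Fin (m + 1), fam (Function.update (Fin.tail L) i (Fin.tail L i ||| L 0)) =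
        Function.update (Fin.tail (fam L : Fin (m + 2) → Finset (Fin n) → ℝ)) i (Fin.tail (fam L) i * fam L 0) := by
      intro i
      funext j
      by_cases hj : j = i
      · subst hj
        rw [Function.update_self, fam, Function.update_self, ofMask_or, ← prod_realF_mul]; rfl
      · rw [Function.update_of_ne hj, fam, Function.update_of_ne hj]; rfl
    have h0 : val β (L 0) = ex (realW β) (fam L 0) := by rw [fam, PrincipalCapBeta.ex_realW_prod]; rfl
    rw [htail, h0, sum_congr rfl fun i _ => by rw [symE_sound β huniv (m + 1), hupd i]]
    push_cast; ring

/-- The singleton family is the coordinate family, so `symE` of the singleton masks is `Φ_{n}`. [this work] -/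
theorem evalP_symE_singletons (β : Finset (Fin (n + 1)) → ℝ) (huniv : β univ = 1) :
    evalP (val β) (symE (n + 1) (n + 1) fun i => 2 ^ (i : ℕ)) = PrincipalCapBeta.phiSet (n + 1) β := by
  rw [symE_sound β huniv, PrincipalCapBeta.phiSet_eq_sahiE_real]
  congr 1
  funext i
  rw [fam, ofMask_two_pow, prod_singleton]

end Model

/-! ## Certificates: atoms, products, orbit expansion -/

/-- The atoms `b_S = β_S`, `d_S = 1 − β_S`, `h(S;A,B) = β_S − β_A β_B`. [this work] -/
inductive Atom
  | b (S : ℕ)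
  | d (S : ℕ)
  | h (S A B : ℕ)
  deriving DecidableEq, Repr

/-- The polynomial of an atom. [this work] -/
def atomPoly (n : ℕ) : Atom → Poly
  | .b S => mono n S
  | .d S => ([], 1) :: scaleP (-1) (mono n S)
  | .h S A B => mono n S ++ scaleP (-1) (mulP (mono n A) (mono n B))

/-- The value of an atom. [this work] -/
noncomputable def atomVal (v : ℕ → ℝ) : Atom → ℝ
  | .b S => v S
  | .d S => 1 - v S
  | .h S A B => v S - v A * v B

/-- Well-formedness: the cover of an `h`-atom is exact. [this work] -/
def Atom.wf : Atom → Bool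
  | .h S A B => (A ||| B) == S
  | _ => true

/-- `atomPoly` evaluates to `atomVal`. [this work] -/
theorem evalP_atomPoly {n : ℕ} (β : Finset (Fin n) → ℝ) (huniv : β univ = 1) (a : Atom) :
    evalP (val β) (atomPoly n a) = atomVal (val β) a := by
  cases a with
  | b S => rw [atomPoly, atomVal, evalP_mono β huniv]
  | d S => rw [atomPoly, atomVal, evalP, evalP_scaleP, evalP_mono β huniv, evalM]; push_cast; ring
  | h S A B =>
    rw [atomPoly, atomVal, evalP_append, evalP_scaleP, evalP_mulP, evalP_mono β huniv, evalP_mono β huniv,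
      evalP_mono β huniv]; push_cast; ring

/-- Atoms are nonnegative on the constraint set of `F(n)`. [this work] -/
theorem atomVal_nonneg {n : ℕ} (β : Finset (Fin n) → ℝ) (h0 : ∀ B, 0 ≤ β B) (h1 : ∀ B, β B ≤ 1)
    (hsup : ∀ S T, β S * β T ≤ β (S ∪ T)) (a : Atom) (ha : a.wf = true) : 0 ≤ atomVal (val β) a := by
  cases a with
  | b S => exact h0 _
  | d S => rw [atomVal]; exact sub_nonneg.2 (h1 _)
  | h S A B =>
    have hS : A ||| B = S := by simpa [Atom.wf] using ha
    rw [atomVal, sub_nonneg, val, val, val, ← hS, ofMask_or]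
    exact hsup _ _

/-- The polynomial of a product of atoms. [this work] -/
def prodP (n : ℕ) : List Atom → Poly
  | [] => [([], 1)]
  | a :: as => mulP (atomPoly n a) (prodP n as)

/-- `prodP` evaluates to the product of the atom values. [this work] -/
theorem evalP_prodP {n : ℕ} (β : Finset (Fin n) → ℝ) (huniv : β univ = 1) :
    ∀ as : List Atom, evalP (val β) (prodP n as) = (as.map (atomVal (val β))).prod
  | [] => by rw [prodP, evalP, evalP, evalM, List.map_nil, List.prod_nil]; push_cast; ring
  | a :: as => by rw [prodP, evalP_mulP, evalP_atomPoly β huniv, evalP_prodP β huniv as, List.map_cons, List.prod_cons]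

/-- The polynomial of a weighted list of products. [this work] -/
def termsPoly (n : ℕ) : List (ℤ × List Atom) → Poly
  | [] => []
  | t :: T => scaleP t.1 (prodP n t.2) ++ termsPoly n T

/-- Data check: nonnegative weights and well-formed atoms. [this work] -/
def checkT : List (ℤ × List Atom) → Bool
  | [] => true
  | t :: T => (decide (0 ≤ t.1) && t.2.all Atom.wf) && checkT T

/-- **Soundness of certificates**: a checked weighted list of atom products evaluates to a nonnegative number on the constraint set.
[this work] -/
theorem termsPoly_nonneg {n : ℕ} (β : Finset (Fin n) → ℝ) (h0 : ∀ B, 0 ≤ β B) (h1 : ∀ B, β B ≤ 1) (huniv : β univ = 1)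
    (hsup : ∀ S T, β S * β T ≤ β (S ∪ T)) :
    ∀ T : List (ℤ × List Atom), checkT T = true → 0 ≤ evalP (val β) (termsPoly n T)
  | [], _ => by rw [termsPoly, evalP]
  | t :: T, hT => by
    rw [checkT, Bool.and_eq_true, Bool.and_eq_true] at hT
    obtain ⟨⟨hw, hwf⟩, hT'⟩ := hT
    rw [termsPoly, evalP_append, evalP_scaleP, evalP_prodP β huniv]
    refine add_nonneg (mul_nonneg (by exact_mod_cast of_decide_eq_true hw) (List.prod_nonneg fun x hx => ?_))
      (termsPoly_nonneg β h0 h1 huniv hsup T hT')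
    obtain ⟨a, ha, rfl⟩ := List.mem_map.1 hx
    exact atomVal_nonneg β h0 h1 hsup a (List.all_eq_true.1 hwf a ha)

/-! ### Orbit expansion (no soundness needed beyond `checkT` of the output) -/

/-- All insertions of `a` into a list. [this work] -/
def insertAll (a : ℕ) : List ℕ → List (List ℕ)
  | [] => [[a]]
  | b :: l => (a :: b :: l) :: (insertAll a l).map (b :: ·)

/-- All permutations of a list (structural recursion). [this work] -/
def perms : List ℕ → List (List ℕ)
  | [] => [[]]
  | a :: l => (perms l).flatMap (insertAll a)

/-- Image of a bitmask under the map `i ↦ g[i]`. [this work] -/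
def permMask (g : List ℕ) (S : ℕ) : ℕ :=
  (List.range g.length).foldl (fun acc i => if S.testBit i then acc ||| (1 <<< g.getD i 0) else acc) 0

/-- Image of an atom under a permutation (covers stored with `A ≤ B`). [this work] -/
def permAtom (g : List ℕ) : Atom → Atom
  | .b S => .b (permMask g S)
  | .d S => .d (permMask g S)
  | .h S A B =>
    let A' := permMask g A
    let B' := permMask g B
    .h (permMask g S) (min A' B') (max A' B')

/-- An injective numeric key for atoms (masks below `2^10`). [this work] -/
def atomKey : Atom → ℕ
  | .b S => 4 * S
  | .d S => 4 * S + 1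
  | .h S A B => 4 * ((S * 1024 + A) * 1024 + B) + 2

/-- Lexicographic comparison of key lists. [this work] -/
def keysLE : List ℕ → List ℕ → Bool
  | [], _ => true
  | _ :: _, [] => false
  | a :: l₁, b :: l₂ => if a = b then keysLE l₁ l₂ else Nat.blt a b

/-- Remove adjacent duplicates. [this work] -/
def dedupAdj : List (List ℕ) → List (List ℕ)
  | [] => []
  | x :: l => match dedupAdj l with
    | [] => [x]
    | y :: l' => if x = y then y :: l' else x :: y :: l'

/-- Decode a key back to an atom. [this work] -/
def atomOfKey (K : ℕ) : Atom :=
  if K % 4 = 0 then .b (K / 4)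
  else if K % 4 = 1 then .d (K / 4)
  else
    let q := K / 4
    .h (q / (1024 * 1024)) ((q / 1024) % 1024) (q % 1024)

/-- The distinct images of a product of atoms under all permutations of `{0,…,n−1}`, each with the weight `c · (n! / #images)`.
[this work] -/
def orbitTerms (n : ℕ) (c : ℤ) (as : List Atom) : List (ℤ × List Atom) :=
  let imgs := (perms (List.range n)).map fun g =>
    msortBy (fun a b => Nat.ble a b) as.length ((as.map (permAtom g)).map atomKey)
  let srt := dedupAdj (msortBy keysLE imgs.length imgs)
  let w : ℤ := c * ((Nat.factorial n / srt.length : ℕ) : ℤ)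
  srt.map fun ks => (w, ks.map atomOfKey)

/-- The symmetrised certificate as a weighted list of products. [this work] -/
def certTerms (n : ℕ) (C : List (ℤ × List Atom)) : List (ℤ × List Atom) :=
  C.flatMap fun t => orbitTerms n t.1 t.2

/-! ## The final check and its soundness -/

/-- **The check**: data well-formed, and `M · Φ_n` and the symmetrised certificate have the same normal form. [this work] -/
def verify (n M : ℕ) (C : List (ℤ × List Atom)) : Bool :=
  let T := certTerms n C
  checkT T && decide (normP (scaleP M (symE n n fun i => 2 ^ (i : ℕ))) = normP (termsPoly n T))

/-- **Reflection**: a successful check proves `F(n+1)` (`PhiNonneg (n+1)`). [this work] -/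
theorem phiNonneg_of_verify (n M : ℕ) (hM : 0 < M) (C : List (ℤ × List Atom)) (h : verify (n + 1) M C = true) :
    PrincipalCapBeta.PhiNonneg (n + 1) := by
  intro β h0 h1 huniv hsup
  rw [verify, Bool.and_eq_true, decide_eq_true_eq] at h
  obtain ⟨hT, hid⟩ := h
  have key : (M : ℝ) * PrincipalCapBeta.phiSet (n + 1) β = evalP (val β) (termsPoly (n + 1) (certTerms (n + 1) C)) := by
    rw [← evalP_symE_singletons β huniv, ← evalP_normP (val β) (termsPoly _ _), ← hid, evalP_normP, evalP_scaleP]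
    push_cast; ring
  have hnn := termsPoly_nonneg β h0 h1 huniv hsup _ hT
  rw [← key] at hnn
  exact (mul_nonneg_iff_of_pos_left (by exact_mod_cast hM)).1 hnn

end PhiCert

end Summit.CriticalPhenomena.PercolationContinuityZ3.Theorems
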